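import Mathlib.Probability.Moments.Covariance
import Literature.MathematicalPhysics.QuantumFieldTheory.LatticeGaugeProofs
import Literature.MathematicalPhysics.QuantumFieldTheory.LatticeGaugeStaticPotentialProofs
import Literature.MathematicalPhysics.QuantumFieldTheory.YangMillsOS
import Literature.MathematicalPhysics.QuantumLattice.LatticeGaugeDLR
import Literature.Probability.LatticeModels.SharpnessProofs
import HarnessLib

/-!
# Mirror reduction: time-axis positive-orientation domination ⇒ mirror domination everywhere

Crux `stmt-QuantumFields-9442`
(`Summit.QuantumFields.YangMills.Theses.FradkinShenkerFlow.FiniteSusceptibilityWeakCoupling`), line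
`sup-axis-reflection-transfer`, stub `stub_mirrorReduction`
(`MirrorDominationAxis0 → MirrorDomination`).

What is proved: the hyperoctahedral bookkeeping. ASSUMING that for every compact `G`, every
`β ≥ 0` and EVERY pair of species `(A, B)` the torus covariances `|Cov_S(A∘lift, B∘τ_x∘lift)|` at
translates `x` whose sup norm is attained by the time coordinate with positive sign
(`x 0 = ‖x‖∞ ≥ n₀`) are dominated by a lag window of axis-`0` covariances of finitely many fixed
species pairs, the same domination (with all four axes on the right) holds for EVERY translate `x`
with `‖x‖∞ ≥ n₀`. Tools:

* (N) sign flip `Cov_S(A, τ_y B) = Cov_S(B, τ_{-y} A)` (`covariance_comm` + torus translation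
  invariance `wilsonMeasure_map_torusConfigShift`, `toTorusObservable_comp_configShift`);
* (K) axis transport `Cov_S(A, τ_y B) = Cov_S(A^π, τ_{π⁻¹ y} B^π)` with the permuted species
  `A^π := A ∘ configPermZd π` (`exists_permSpecies`; `wilsonMeasure_map_configPerm`,
  `toTorusObservable_comp_configPermZd`), `π = Equiv.swap 0 μ`;
* (E) the `8 = 4 × 2` data sets (axes × signs) supplied by the hypothesis are extracted with
  `choose` before `S, x` are fixed and packaged into one list through `Fintype.equivFin` of a
  sigma type; all right-hand terms are `|cov| ≥ 0`, so enlarging index sets, windows and constants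
  only helps (`package`, pure finite-sum bookkeeping).

Here `Cov_S(A∘lift, B∘τ_y∘lift)` always stands for the literal term
`cov[fun U => A.F (torusLift (2S+1) U), fun U => B.F (configShift (-y) (torusLift (2S+1) U)); μ_S]`
with `μ_S = wilsonMeasure (d := 4) (L := 2S+1) r.ρ β`, written out in full everywhere (no shorthand
is introduced, so this support file declares theorems only). No new facts; everything is
[folklore].
-/

noncomputable section

open MeasureTheory ProbabilityTheory
open scoped BigOperators
open Literature.MathematicalPhysics.QuantumFieldTheory hiding Site ZdEdge
open Literature.MathematicalPhysics.QuantumLattice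
open Literature.Probability.LatticeModels hiding configShift configShift_apply

namespace Summit.QuantumFields.YangMills.Theorems.FiniteSusceptibilityWeakCoupling

namespace MirrorReduction

variable {G : Type} [Group G] [TopologicalSpace G] [IsTopologicalGroup G] [CompactSpace G]
  [MeasurableSpace G] [BorelSpace G]

/-! ### Permuted species -/

omit [TopologicalSpace G] [IsTopologicalGroup G] [CompactSpace G] [BorelSpace G] in
/-- Coordinate permutations are gauge covariant: `π_* (U^g) = (π_* U)^{g ∘ π⁻¹}`. [folklore] -/
theorem configPermZd_gaugeTransformZd {d : ℕ} (π : Equiv.Perm (Fin d)) (g : Site d → G)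
    (U : LGConfig d G) :
    configPermZd π (gaugeTransformZd g U) =
      gaugeTransformZd (g ∘ sitePermZd π.symm) (configPermZd π U) := by
  funext e
  simp only [configPermZd_apply, gaugeTransformZd, Function.comp_apply, sitePermZd_add,
    sitePermZd_single]

omit [TopologicalSpace G] [IsTopologicalGroup G] [CompactSpace G] [BorelSpace G] in
/-- **Permuted species exist**: `A^π := A ∘ π_*`, a local gauge-invariant observable composed with
a permutation of the coordinate axes, is again a local gauge-invariant observable (support permuted
— `IsCylinder.comp_configPermZd`; gauge invariant by `configPermZd_gaugeTransformZd`; same bound;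
measurable as a composition with a measurable equivalence). Stated as an existence: only the
observable `A'.F = A.F ∘ configPermZd π` of the witness is ever used below. [folklore] -/
theorem exists_permSpecies (π : Equiv.Perm (Fin 4)) (A : YMSpecies G) :
    ∃ A' : YMSpecies G, ∀ U, A'.F U = A.F (configPermZd π U) :=
  ⟨{ F := A.F ∘ configPermZd π
     supp := A.supp.image fun e => (sitePermZd π.symm e.1, π.symm e.2)
     isCylinder := IsCylinder.comp_configPermZd A.isCylinder π
     gaugeInvariant := fun g U => by
       simp only [Function.comp_apply, configPermZd_gaugeTransformZd]
       exact A.gaugeInvariant _ _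
     bounded := by
       obtain ⟨C, hC⟩ := A.bounded
       exact ⟨C, fun U => hC _⟩
     measurable := A.measurable.comp (configPermZd π).measurable }, fun _ => rfl⟩

/-! ### Configuration-level intertwining identities -/

omit [Group G] [TopologicalSpace G] [IsTopologicalGroup G] [CompactSpace G] [BorelSpace G] in
/-- The periodic lift intertwines `configShift v` with the torus shift by `v mod L`. [folklore] -/
theorem configShift_torusLift (L : ℕ) (v : Site 4) (U : GaugeConfig 4 L G) :
    configShift v (torusLift L U) = torusLift L (torusConfigShift (Torus.proj L v) U) :=
  congrFun (toTorusObservable_comp_configShift (G := G) L v id) U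

omit [Group G] [TopologicalSpace G] [IsTopologicalGroup G] [CompactSpace G] [BorelSpace G] in
/-- The periodic lift intertwines the coordinate permutations of `ℤ⁴` and of the torus.
[folklore] -/
theorem configPermZd_torusLift (L : ℕ) (π : Equiv.Perm (Fin 4)) (U : GaugeConfig 4 L G) :
    configPermZd π (torusLift L U) = torusLift L (configPerm π U) :=
  congrFun (toTorusObservable_comp_configPermZd (G := G) L π id) U

/-- `sitePermZd` commutes with negation. [folklore] -/
theorem sitePermZd_neg {d : ℕ} (π : Equiv.Perm (Fin d)) (x : Site d) :
    sitePermZd π (-x) = -sitePermZd π x := rfl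

/-- `sitePermZd π` undoes `sitePermZd π⁻¹`. [folklore] -/
@[simp] theorem sitePermZd_sitePermZd_symm {d : ℕ} (π : Equiv.Perm (Fin d)) (x : Site d) :
    sitePermZd π (sitePermZd π.symm x) = x := by
  funext j
  simp [sitePermZd_apply]

omit [Group G] [TopologicalSpace G] [IsTopologicalGroup G] [CompactSpace G] [BorelSpace G] in
/-- Coordinate permutations and translations of `ℤ⁴`-configurations:
`π_* ∘ θ_v = θ_{π v} ∘ π_*`. [folklore] -/
theorem configPermZd_configShift (π : Equiv.Perm (Fin 4)) (v : Site 4) (V : LGConfig 4 G) :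
    configPermZd π (configShift v V) = configShift (sitePermZd π v) (configPermZd π V) := by
  funext e
  simp only [configShift_apply, configPermZd_apply]
  congr 2
  funext j
  simp [sitePermZd_apply]

omit [Group G] [TopologicalSpace G] [IsTopologicalGroup G] [CompactSpace G] [BorelSpace G] in
/-- Opposite torus shifts cancel: `θ_{(-y) mod L} ∘ θ_{y mod L} = id`. [folklore] -/
theorem torusConfigShift_proj_neg_proj (L : ℕ) (y : Site 4) (U : GaugeConfig 4 L G) :
    torusConfigShift (Torus.proj L (-y)) (torusConfigShift (Torus.proj L y) U) = U := by
  funext e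
  simp only [torusConfigShift_apply]
  congr 1
  refine Prod.ext ?_ rfl
  funext i
  simp [Torus.proj_apply]

/-! ### The two symmetries (K), (N) of the torus covariances -/

/-- **(K) axis transport**: `Cov_S(A, τ_y B) = Cov_S(A^π, τ_{π⁻¹ y} B^π)` for any realisations
`A', B'` of the permuted species — the torus Wilson state is invariant under `configPerm π`
(`wilsonMeasure_map_configPerm`) and the periodic lift intertwines. [folklore] -/
theorem cov_perm (r : LatticeRep G) (β : ℝ) (S : ℕ) (A B A' B' : YMSpecies G) (y : Site 4)
    (π : Equiv.Perm (Fin 4)) (hA : ∀ U, A'.F U = A.F (configPermZd π U))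
    (hB : ∀ U, B'.F U = B.F (configPermZd π U)) :
    cov[fun U => A.F (torusLift (2 * S + 1) U),
        fun U => B.F (configShift (-y) (torusLift (2 * S + 1) U));
        wilsonMeasure (d := 4) (L := 2 * S + 1) r.ρ β] =
      cov[fun U => A'.F (torusLift (2 * S + 1) U),
        fun U => B'.F (configShift (-(sitePermZd π.symm y)) (torusLift (2 * S + 1) U));
        wilsonMeasure (d := 4) (L := 2 * S + 1) r.ρ β] := by
  conv_lhs => rw [← wilsonMeasure_map_configPerm r.ρ r.continuous β π]
  rw [covariance_map_equiv]
  simp only [Function.comp_def, hA, hB, configPermZd_configShift, sitePermZd_neg,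
    sitePermZd_sitePermZd_symm, configPermZd_torusLift]

/-- **(N) sign flip**: `Cov_S(A, τ_y B) = Cov_S(B, τ_{-y} A)` — symmetry of the covariance and
translation invariance of the torus Wilson state (`wilsonMeasure_map_torusConfigShift`); the double
negation on the right is kept literal so that (K) applies to it verbatim. [folklore] -/
theorem cov_swap (r : LatticeRep G) (β : ℝ) (S : ℕ) (A B : YMSpecies G) (y : Site 4) :
    cov[fun U => A.F (torusLift (2 * S + 1) U),
        fun U => B.F (configShift (-y) (torusLift (2 * S + 1) U));
        wilsonMeasure (d := 4) (L := 2 * S + 1) r.ρ β] =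
      cov[fun U => B.F (torusLift (2 * S + 1) U),
        fun U => A.F (configShift (-(-y)) (torusLift (2 * S + 1) U));
        wilsonMeasure (d := 4) (L := 2 * S + 1) r.ρ β] := by
  rw [covariance_comm]
  conv_lhs => rw [← wilsonMeasure_map_torusConfigShift r.ρ β (Torus.proj (2 * S + 1) y)]
  rw [covariance_map_equiv]
  simp only [Function.comp_def, configShift_torusLift, torusConfigShift_proj_neg_proj, neg_neg]

/-! ### Sup-norm bookkeeping -/

/-- Coordinate permutations preserve the sup norm. [folklore] -/
theorem supNorm_sitePermZd {d : ℕ} (σ : Equiv.Perm (Fin d)) (x : Site d) :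
    Site.supNorm (sitePermZd σ x) = Site.supNorm x := by
  refine le_antisymm (Site.supNorm_le_iff.2 fun i => ?_) (Site.supNorm_le_iff.2 fun i => ?_)
  · rw [sitePermZd_apply]
    exact Site.natAbs_le_supNorm x _
  · have : x i = sitePermZd σ x (σ i) := by rw [sitePermZd_apply, Equiv.symm_apply_apply]
    rw [this]
    exact Site.natAbs_le_supNorm _ _

/-- Negation preserves the sup norm. [folklore] -/
theorem supNorm_neg {d : ℕ} (x : Site d) : Site.supNorm (-x) = Site.supNorm x := by
  unfold Site.supNorm
  simp only [Pi.neg_apply, Int.natAbs_neg]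

/-- Every `x ∈ ℤ⁴` lies in some orientation class `(μ, s)`: its sup norm is attained by the
coordinate `μ`, with sign `+` (`s = true`) or `-` (`s = false`). [folklore] -/
theorem exists_orient (x : Site 4) :
    ∃ g : Fin 4 × Bool, x g.1 = cond g.2 (Site.supNorm x : ℤ) (-(Site.supNorm x : ℤ)) := by
  obtain ⟨μ, hμ⟩ := Site.exists_natAbs_eq_supNorm ⟨0, Finset.mem_univ _⟩ x
  rcases Int.natAbs_eq (x μ) with h | h
  · exact ⟨(μ, true), by rw [cond_true, ← hμ]; exact h⟩
  · exact ⟨(μ, false), by rw [cond_false, ← hμ]; exact h⟩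

/-! ### (E) packaging finitely many conditional dominations into one -/

/-- **Packaging.** Finitely many conditional dominations (one per orientation class `g`, each by a
lag window of axis-`0` terms of its own finite family) whose conditions cover every translate
combine into ONE unconditional domination by the concatenated family, with all axes on the right:
every right-hand term is nonnegative, so enlarging the constant (`Σ c_g`), the window (`max w_g`),
the threshold (`max n₀_g`), the index set (the sigma type of all families) and the axis set only
helps. [folklore] -/
theorem package {α ι : Type*} [Fintype ι] (F : ℕ → Site 4 → ℝ)
    (T : ℕ → α → α → Fin 4 → ℕ → ℝ) (hT : ∀ S a b μ j, 0 ≤ T S a b μ j)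
    (good : ι → Site 4 → Prop) (hcover : ∀ x, ∃ g, good g x) (k : ι → ℕ)
    (P Q : (g : ι) → Fin (k g) → α) (c : ι → ℝ) (w n₀ : ι → ℕ) (hc : ∀ g, 0 ≤ c g)
    (hdom : ∀ g S, ∀ x ∈ box 4 S, n₀ g ≤ Site.supNorm x → good g x →
      F S x ≤ c g * ∑ j ∈ (Finset.range (S + 1)).filter
          (fun j => Site.supNorm x ≤ j + w g ∧ j ≤ Site.supNorm x + w g),
        ∑ i, T S (P g i) (Q g i) 0 j) :
    ∃ (K : ℕ) (P' Q' : Fin K → α) (c' : ℝ) (w' n₀' : ℕ), 0 ≤ c' ∧ ∀ S, ∀ x ∈ box 4 S,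
      n₀' ≤ Site.supNorm x →
      F S x ≤ c' * ∑ j ∈ (Finset.range (S + 1)).filter
          (fun j => Site.supNorm x ≤ j + w' ∧ j ≤ Site.supNorm x + w'),
        ∑ i, ∑ μ, T S (P' i) (Q' i) μ j := by
  set e := Fintype.equivFin (Σ g : ι, Fin (k g))
  refine ⟨Fintype.card (Σ g, Fin (k g)), fun i => P (e.symm i).1 (e.symm i).2,
    fun i => Q (e.symm i).1 (e.symm i).2, ∑ g, c g, Finset.univ.sup w, Finset.univ.sup n₀,
    Finset.sum_nonneg fun g _ => hc g, fun S x hx hn => ?_⟩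
  obtain ⟨g, hg⟩ := hcover x
  have hn₀ : n₀ g ≤ Site.supNorm x := (Finset.le_sup (f := n₀) (Finset.mem_univ g)).trans hn
  have hw : w g ≤ Finset.univ.sup w := Finset.le_sup (f := w) (Finset.mem_univ g)
  have hTT : ∀ j, 0 ≤ ∑ i, ∑ μ,
      T S (P (e.symm i).1 (e.symm i).2) (Q (e.symm i).1 (e.symm i).2) μ j :=
    fun j => Finset.sum_nonneg fun i _ => Finset.sum_nonneg fun μ _ => hT _ _ _ _ _
  refine (hdom g S x hx hn₀ hg).trans (mul_le_mul (Finset.single_le_sum (fun g _ => hc g)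
    (Finset.mem_univ g)) ?_
    (Finset.sum_nonneg fun j _ => Finset.sum_nonneg fun i _ => hT _ _ _ _ _)
    (Finset.sum_nonneg fun g _ => hc g))
  refine (Finset.sum_le_sum fun j _ => ?_).trans
    (Finset.sum_le_sum_of_subset_of_nonneg (Finset.monotone_filter_right _ fun j _ hj => ?_)
      fun j _ _ => hTT j)
  · calc ∑ i, T S (P g i) (Q g i) 0 j
        ≤ ∑ i, ∑ μ, T S (P g i) (Q g i) μ j := Finset.sum_le_sum fun i _ =>
          Finset.single_le_sum (f := fun μ => T S (P g i) (Q g i) μ j) (fun μ _ => hT _ _ _ _ _)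
            (Finset.mem_univ 0)
      _ ≤ ∑ g', ∑ i, ∑ μ, T S (P g' i) (Q g' i) μ j :=
          Finset.single_le_sum (f := fun g' => ∑ i, ∑ μ, T S (P g' i) (Q g' i) μ j)
            (fun g' _ => Finset.sum_nonneg fun i _ => Finset.sum_nonneg fun μ _ => hT _ _ _ _ _)
            (Finset.mem_univ g)
      _ = ∑ t : (Σ g', Fin (k g')), ∑ μ, T S (P t.1 t.2) (Q t.1 t.2) μ j :=
          (Fintype.sum_sigma' fun g' i => ∑ μ, T S (P g' i) (Q g' i) μ j).symm
      _ = ∑ i, ∑ μ, T S (P (e.symm i).1 (e.symm i).2) (Q (e.symm i).1 (e.symm i).2) μ j :=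
          (Equiv.sum_comp e.symm fun t => ∑ μ, T S (P t.1 t.2) (Q t.1 t.2) μ j).symm
  · exact ⟨hj.1.trans (Nat.add_le_add_left hw _), hj.2.trans (Nat.add_le_add_left hw _)⟩

/-! ### One orientation class from the time-axis positive-orientation hypothesis -/

/-- **(K)+(N) applied.** If time-axis positive-orientation domination holds for ALL pairs, then
for the pair `(A, B)` and every orientation class `(μ, s)` a conditional domination holds: transport
the class to the time-axis positive class by `π = swap 0 μ` (and, for `s = false`, a sign flip that
swaps the pair), and use the hypothesis for the transformed pair `(A^π, B^π)` resp. `(B^π, A^π)`.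
[folklore] -/
theorem orient_dominated (r : LatticeRep G) (β : ℝ) (A B : YMSpecies G)
    (h0 : ∀ A' B' : YMSpecies G, ∃ (k : ℕ) (P Q : Fin k → YMSpecies G) (c : ℝ) (w n₀ : ℕ),
      0 ≤ c ∧ ∀ S : ℕ, ∀ z ∈ box 4 S, n₀ ≤ Site.supNorm z → z 0 = (Site.supNorm z : ℤ) →
        |cov[fun U => A'.F (torusLift (2 * S + 1) U),
            fun U => B'.F (configShift (-z) (torusLift (2 * S + 1) U));
            wilsonMeasure (d := 4) (L := 2 * S + 1) r.ρ β]| ≤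
          c * ∑ j ∈ (Finset.range (S + 1)).filter
              (fun j => Site.supNorm z ≤ j + w ∧ j ≤ Site.supNorm z + w),
            ∑ i : Fin k, |cov[fun U => (P i).F (torusLift (2 * S + 1) U),
              fun U => (Q i).F (configShift (-(Pi.single 0 (j : ℤ))) (torusLift (2 * S + 1) U));
              wilsonMeasure (d := 4) (L := 2 * S + 1) r.ρ β]|)
    (μ : Fin 4) (s : Bool) :
    ∃ (k : ℕ) (P Q : Fin k → YMSpecies G) (c : ℝ) (w n₀ : ℕ), 0 ≤ c ∧ ∀ S : ℕ, ∀ x ∈ box 4 S,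
      n₀ ≤ Site.supNorm x → x μ = cond s (Site.supNorm x : ℤ) (-(Site.supNorm x : ℤ)) →
        |cov[fun U => A.F (torusLift (2 * S + 1) U),
            fun U => B.F (configShift (-x) (torusLift (2 * S + 1) U));
            wilsonMeasure (d := 4) (L := 2 * S + 1) r.ρ β]| ≤
          c * ∑ j ∈ (Finset.range (S + 1)).filter
              (fun j => Site.supNorm x ≤ j + w ∧ j ≤ Site.supNorm x + w),
            ∑ i : Fin k, |cov[fun U => (P i).F (torusLift (2 * S + 1) U),
              fun U => (Q i).F (configShift (-(Pi.single 0 (j : ℤ))) (torusLift (2 * S + 1) U));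
              wilsonMeasure (d := 4) (L := 2 * S + 1) r.ρ β]| := by
  set π : Equiv.Perm (Fin 4) := Equiv.swap 0 μ with hπ
  -- the transported translate `z = π (±x)`: in the box, same sup norm, time coordinate `(±x) μ`
  have key : ∀ (S : ℕ) (y : Site 4), y ∈ box 4 S →
      sitePermZd π.symm y ∈ box 4 S ∧ Site.supNorm (sitePermZd π.symm y) = Site.supNorm y ∧
        sitePermZd π.symm y 0 = y μ := fun S y hy => by
    refine ⟨?_, supNorm_sitePermZd _ _, ?_⟩
    · rw [mem_box_iff_supNorm_le, supNorm_sitePermZd]; exact mem_box_iff_supNorm_le.1 hy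
    · rw [sitePermZd_apply, Equiv.symm_symm, hπ, Equiv.swap_apply_left]
  obtain ⟨A', hA'⟩ := exists_permSpecies π A
  obtain ⟨B', hB'⟩ := exists_permSpecies π B
  cases s with
  | true =>
    obtain ⟨k, P, Q, c, w, n₀, hc, hdom⟩ := h0 A' B'
    refine ⟨k, P, Q, c, w, n₀, hc, fun S x hx hn hor => ?_⟩
    obtain ⟨hzb, hzn, hz0⟩ := key S x hx
    rw [cov_perm r β S A B A' B' x π hA' hB']
    have := hdom S _ hzb (hzn ▸ hn) (by rw [hz0, hzn]; rw [cond_true] at hor; exact hor)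
    rwa [hzn] at this
  | false =>
    obtain ⟨k, P, Q, c, w, n₀, hc, hdom⟩ := h0 B' A'
    refine ⟨k, P, Q, c, w, n₀, hc, fun S x hx hn hor => ?_⟩
    have hnx : -x ∈ box 4 S := by
      rw [mem_box_iff_supNorm_le, supNorm_neg]; exact mem_box_iff_supNorm_le.1 hx
    obtain ⟨hzb, hzn, hz0⟩ := key S (-x) hnx
    rw [supNorm_neg] at hzn
    rw [cov_swap, cov_perm r β S B A B' A' (-x) π hB' hA']
    have := hdom S _ hzb (hzn ▸ hn)
      (by rw [hz0, hzn, Pi.neg_apply]; rw [cond_false] at hor; rw [hor, neg_neg])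
    rwa [hzn] at this

/-- **Mirror reduction at fixed `(G, r, β)`**: time-axis positive-orientation domination for all
pairs ⇒ mirror domination (all translates, all axes on the right) for every pair. [folklore] -/
theorem mirrorDomination_of_axis0 (r : LatticeRep G) (β : ℝ)
    (h0 : ∀ A' B' : YMSpecies G, ∃ (k : ℕ) (P Q : Fin k → YMSpecies G) (c : ℝ) (w n₀ : ℕ),
      0 ≤ c ∧ ∀ S : ℕ, ∀ z ∈ box 4 S, n₀ ≤ Site.supNorm z → z 0 = (Site.supNorm z : ℤ) →
        |cov[fun U => A'.F (torusLift (2 * S + 1) U),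
            fun U => B'.F (configShift (-z) (torusLift (2 * S + 1) U));
            wilsonMeasure (d := 4) (L := 2 * S + 1) r.ρ β]| ≤
          c * ∑ j ∈ (Finset.range (S + 1)).filter
              (fun j => Site.supNorm z ≤ j + w ∧ j ≤ Site.supNorm z + w),
            ∑ i : Fin k, |cov[fun U => (P i).F (torusLift (2 * S + 1) U),
              fun U => (Q i).F (configShift (-(Pi.single 0 (j : ℤ))) (torusLift (2 * S + 1) U));
              wilsonMeasure (d := 4) (L := 2 * S + 1) r.ρ β]|)
    (A B : YMSpecies G) :
    ∃ (k : ℕ) (P Q : Fin k → YMSpecies G) (c : ℝ) (w n₀ : ℕ), 0 ≤ c ∧ ∀ S : ℕ, ∀ x ∈ box 4 S,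
      n₀ ≤ Site.supNorm x →
        |cov[fun U => A.F (torusLift (2 * S + 1) U),
            fun U => B.F (configShift (-x) (torusLift (2 * S + 1) U));
            wilsonMeasure (d := 4) (L := 2 * S + 1) r.ρ β]| ≤
          c * ∑ j ∈ (Finset.range (S + 1)).filter
              (fun j => Site.supNorm x ≤ j + w ∧ j ≤ Site.supNorm x + w),
            ∑ i : Fin k, ∑ μ : Fin 4, |cov[fun U => (P i).F (torusLift (2 * S + 1) U),
              fun U => (Q i).F (configShift (-(Pi.single μ (j : ℤ))) (torusLift (2 * S + 1) U));
              wilsonMeasure (d := 4) (L := 2 * S + 1) r.ρ β]| := by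
  choose k P Q c w n₀ hc hdom using fun g : Fin 4 × Bool => orient_dominated r β A B h0 g.1 g.2
  exact package
    (fun (S : ℕ) (x : Site 4) => |cov[fun U => A.F (torusLift (2 * S + 1) U),
      fun U => B.F (configShift (-x) (torusLift (2 * S + 1) U));
      wilsonMeasure (d := 4) (L := 2 * S + 1) r.ρ β]|)
    (fun (S : ℕ) (a b : YMSpecies G) (μ : Fin 4) (j : ℕ) =>
      |cov[fun U => a.F (torusLift (2 * S + 1) U),
        fun U => b.F (configShift (-(Pi.single μ (j : ℤ))) (torusLift (2 * S + 1) U));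
        wilsonMeasure (d := 4) (L := 2 * S + 1) r.ρ β]|)
    (fun _ _ _ _ _ => abs_nonneg _)
    (fun g x => x g.1 = cond g.2 (Site.supNorm x : ℤ) (-(Site.supNorm x : ℤ))) exists_orient
    k P Q c w n₀ hc (fun g S x hx hn hg => hdom g S x hx hn hg)

end MirrorReduction

/-- **STUB `stub_mirrorReduction`** (crux `stmt-QuantumFields-9442`, line
`sup-axis-reflection-transfer`): `MirrorDominationAxis0 → MirrorDomination`. Time-axis
positive-orientation mirror domination for ALL species pairs implies mirror domination for every
translate `x` with `‖x‖∞ ≥ n₀`, the right-hand side summed over all four axes — by the sign flip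
(N), the axis transport (K) through permuted species, and the packaging (E) of the eight resulting
data sets (`MirrorReduction.mirrorDomination_of_axis0`). [folklore] -/
theorem stub_mirrorReduction : (∀ (G : Type) [Group G] [TopologicalSpace G] [IsTopologicalGroup G] [CompactSpace G] [MeasurableSpace G] [BorelSpace G] (r : Literature.MathematicalPhysics.QuantumFieldTheory.LatticeRep G) (β : ℝ), 0 ≤ β → ∀ A B : Literature.MathematicalPhysics.QuantumFieldTheory.YMSpecies G, ∃ (k : ℕ) (P Q : Fin k → Literature.MathematicalPhysics.QuantumFieldTheory.YMSpecies G) (c : ℝ) (w n₀ : ℕ), 0 ≤ c ∧ ∀ S : ℕ, ∀ x ∈ Literature.Probability.LatticeModels.box 4 S, n₀ ≤ Literature.Probability.LatticeModels.Site.supNorm x → x 0 = (Literature.Probability.LatticeModels.Site.supNorm x : ℤ) → |ProbabilityTheory.covariance (fun U => A.F (Literature.MathematicalPhysics.QuantumLattice.torusLift (2 * S + 1) U)) (fun U => B.F (Literature.MathematicalPhysics.QuantumLattice.configShift (-x) (Literature.MathematicalPhysics.QuantumLattice.torusLift (2 * S + 1) U))) (Literature.MathematicalPhysics.QuantumFieldTheory.wilsonMeasure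 (d := 4) (L := 2 * S + 1) r.ρ β)| ≤ c * ∑ j ∈ (Finset.range (S + 1)).filter (fun j => Literature.Probability.LatticeModels.Site.supNorm x ≤ j + w ∧ j ≤ Literature.Probability.LatticeModels.Site.supNorm x + w), ∑ i : Fin k, |ProbabilityTheory.covariance (fun U => (P i).F (Literature.MathematicalPhysics.QuantumLattice.torusLift (2 * S + 1) U)) (fun U => (Q i).F (Literature.MathematicalPhysics.QuantumLattice.configShift (-(Pi.single 0 (j : ℤ))) (Literature.MathematicalPhysics.QuantumLattice.torusLift (2 * S + 1) U))) (Literature.MathematicalPhysics.QuantumFieldTheory.wilsonMeasure (d := 4) (L := 2 * S + 1) r.ρ β)|) → ∀ (G : Type) [Group G] [TopologicalSpace G] [IsTopologicalGroup G] [CompactSpace G] [MeasurableSpace G] [BorelSpace G] (r : Literature.MathematicalPhysics.QuantumFieldTheory.LatticeRep G) (β : ℝ), 0 ≤ β → ∀ A B : Literature.MathematicalPhysics.QuantumFieldTheory.YMSpecies G, ∃ (k : ℕ) (P Q : Fin k → Literature.MathematicalPhysics.QuantumFieldTheory.YMSpecies G) (c : ℝ) (w n₀ : ℕ), 0 ≤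 c ∧ ∀ S : ℕ, ∀ x ∈ Literature.Probability.LatticeModels.box 4 S, n₀ ≤ Literature.Probability.LatticeModels.Site.supNorm x → |ProbabilityTheory.covariance (fun U => A.F (Literature.MathematicalPhysics.QuantumLattice.torusLift (2 * S + 1) U)) (fun U => B.F (Literature.MathematicalPhysics.QuantumLattice.configShift (-x) (Literature.MathematicalPhysics.QuantumLattice.torusLift (2 * S + 1) U))) (Literature.MathematicalPhysics.QuantumFieldTheory.wilsonMeasure (d := 4) (L := 2 * S + 1) r.ρ β)| ≤ c * ∑ j ∈ (Finset.range (S + 1)).filter (fun j => Literature.Probability.LatticeModels.Site.supNorm x ≤ j + w ∧ j ≤ Literature.Probability.LatticeModels.Site.supNorm x + w), ∑ i : Fin k, ∑ μ : Fin 4, |ProbabilityTheory.covariance (fun U => (P i).F (Literature.MathematicalPhysics.QuantumLattice.torusLift (2 * S + 1) U)) (fun U => (Q i).F (Literature.MathematicalPhysics.QuantumLattice.configShift (-(Pi.single μ (j : ℤ))) (Literature.MathematicalPhysics.QuantumLattice.torusLift (2 * S + 1) U))) (Literature.MathematicalPhysics.QuantumFieldTheory.wilsonMeasure (d := 4) (L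 := 2 * S + 1) r.ρ β)| := by
  intro h G _ _ _ _ _ _ r β hβ A B
  exact MirrorReduction.mirrorDomination_of_axis0 r β (fun A' B' => h G r β hβ A' B') A B

end Summit.QuantumFields.YangMills.Theorems.FiniteSusceptibilityWeakCoupling

end
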